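import Literature.Analysis.Complex.PolydiscWeightedMeanValue
import Mathlib.MeasureTheory.Constructions.Pi
import HarnessLib

/-!
# The weighted mean value property of holomorphic functions of TWO complex variables for EUCLIDEAN-radial weights

Topic `Literature/Analysis/Complex`; namespace `Literature.Analysis.Complex`.  Theorems only (no definition, no named fact, no `sorry`).

The sibling ★ `PolydiscWeightedMeanValue` proves the area mean value property of a holomorphic function of ONE variable against a smooth radial weight,
`∫_ℂ b(|w|) g(w) dA = (∫_ℂ b(|w|) dA)·g(0)` (`integral_radial_smul_eq_smul`), and its product form over polydiscs.  Here the weight is radial for the EUCLIDEAN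
norm `|z₁|² + |z₂|²` of `ℂ²` (invariant under the unitary group `U(2)`, which is what the automorphic application needs — the reproducing kernel of a weight-`τ`
holomorphic form must be `K = U(2)×U(1)`-equivariant):

* `integral_euclidRadial_smul_eq_smul_prod` — for `f` holomorphic on an open `U ⊇` the closed polydisc `max(|a|,|w|) ≤ R` of `ℂ × ℂ`, `β` continuous with `β(s) = 0` for
  `s ≥ R₁²`, `0 < R₁ < R`:  `∫_{ℂ×ℂ} β(|a|²+|w|²) f(a,w) dA = (∫_{ℂ×ℂ} β(|a|²+|w|²) dA) · f(0,0)`;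
* `integral_euclidRadial_smul_eq_smul` — the same on `ℂ² = Fin 2 → ℂ` (transport along `MeasurableEquiv.finTwoArrow`, measure preserving).

Proof: Fubini; for fixed `a` the weight `w ↦ β(|a|²+|w|²)` is radial in `w`, so the one-variable lemma replaces `f(a,w)` by `f(a,0)` under `∫ dw`; swap the order; for fixed
`w` the weight `a ↦ β(|a|²+|w|²)` is radial in `a`, so the one-variable lemma replaces `f(a,0)` by `f(0,0)` under `∫ da`.  (No several-variables theory — Osgood∕Hartogs — is used: `f`
is assumed `ℂ`-Fréchet-differentiable, hence holomorphic in each variable separately.)  This is the torus∕sphere mean value property integrated against the radial profile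
([Rudin1980, §1.4, Prop. 1.4.7 and (1) of §1.4.2: integration in polar coordinates on `ℂⁿ` and the invariance of the measure under the torus]).

## References
* [Rudin1980] W. Rudin, *Function Theory in the Unit Ball of ℂⁿ*, Grundlehren 241 (1980), §1.4.
* [Krantz2001] S. G. Krantz, *Function Theory of Several Complex Variables*, 2nd ed. (2001), §1.1–1.3 (mean value ∕ Cauchy on polydiscs).
-/

noncomputable section

open MeasureTheory Metric Set Filter
open scoped Topology

namespace Literature.Analysis.Complex

section TwoVariables

variable {F : Type*} [NormedAddCommGroup F] [NormedSpace ℂ F] [CompleteSpace F]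

/-- The Euclidean-radial weight `(a, w) ↦ β(|a|² + |w|²)` on `ℂ × ℂ` is continuous. [cite: Rudin1980, §1.4] -/
theorem continuous_euclidRadial {β : ℝ → ℝ} (hβ : Continuous β) : Continuous fun p : ℂ × ℂ => β (‖p.1‖ ^ 2 + ‖p.2‖ ^ 2) := by
  fun_prop

/-- If `β(s) = 0` for `s ≥ R₁²` and `β(|a|²+|w|²) ≠ 0` then `max(|a|,|w|) < R₁`. [cite: Rudin1980, §1.4] -/
theorem norm_lt_of_euclidRadial_ne_zero {β : ℝ → ℝ} {R₁ : ℝ} (hR₁ : 0 < R₁) (hβR : ∀ s, R₁ ^ 2 ≤ s → β s = 0) {p : ℂ × ℂ}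
    (hp : β (‖p.1‖ ^ 2 + ‖p.2‖ ^ 2) ≠ 0) : ‖p‖ < R₁ := by
  have hs : ‖p.1‖ ^ 2 + ‖p.2‖ ^ 2 < R₁ ^ 2 := by
    by_contra h
    exact hp (hβR _ (le_of_not_gt h))
  have h1 : ‖p.1‖ < R₁ :=
    lt_of_pow_lt_pow_left₀ 2 hR₁.le (by nlinarith [norm_nonneg p.2, norm_nonneg p.1])
  have h2 : ‖p.2‖ < R₁ :=
    lt_of_pow_lt_pow_left₀ 2 hR₁.le (by nlinarith [norm_nonneg p.2, norm_nonneg p.1])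
  rw [Prod.norm_def]
  exact max_lt h1 h2

/-- The support of the Euclidean-radial weight lies in the closed sup-norm ball of radius `R₁`. [cite: Rudin1980, §1.4] -/
theorem tsupport_euclidRadial_subset {β : ℝ → ℝ} {R₁ : ℝ} (hR₁ : 0 < R₁) (hβR : ∀ s, R₁ ^ 2 ≤ s → β s = 0) :
    tsupport (fun p : ℂ × ℂ => β (‖p.1‖ ^ 2 + ‖p.2‖ ^ 2)) ⊆ closedBall (0 : ℂ × ℂ) R₁ := by
  refine closure_minimal (fun p hp => ?_) isClosed_closedBall
  rw [mem_closedBall_zero_iff]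
  exact (norm_lt_of_euclidRadial_ne_zero hR₁ hβR hp).le

/-- The Euclidean-radial weight is integrable on `ℂ × ℂ` (continuous, compactly supported). [cite: Rudin1980, §1.4] -/
theorem integrable_euclidRadial {β : ℝ → ℝ} (hβ : Continuous β) {R₁ : ℝ} (hR₁ : 0 < R₁) (hβR : ∀ s, R₁ ^ 2 ≤ s → β s = 0) :
    Integrable fun p : ℂ × ℂ => β (‖p.1‖ ^ 2 + ‖p.2‖ ^ 2) := by
  refine (continuous_euclidRadial hβ).integrable_of_hasCompactSupport ?_
  refine HasCompactSupport.intro (isCompact_closedBall (0 : ℂ × ℂ) R₁) fun p hp => ?_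
  rw [mem_closedBall_zero_iff, not_le] at hp
  by_contra h
  exact (lt_irrefl _) ((norm_lt_of_euclidRadial_ne_zero hR₁ hβR h).trans hp)

omit [CompleteSpace F] in
/-- Integrability of the weighted integrand `β(|a|²+|w|²) • h(a,w)` for `h` continuous on an open set containing the closed sup-ball of radius `R₁`. [cite: Rudin1980, §1.4] -/
theorem integrable_euclidRadial_smul {β : ℝ → ℝ} (hβ : Continuous β) {R₁ : ℝ} (hR₁ : 0 < R₁) (hβR : ∀ s, R₁ ^ 2 ≤ s → β s = 0)
    {h : ℂ × ℂ → F} {O : Set (ℂ × ℂ)} (hO : IsOpen O) (hh : ContinuousOn h O) (hsub : closedBall (0 : ℂ × ℂ) R₁ ⊆ O) :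
    Integrable fun p : ℂ × ℂ => β (‖p.1‖ ^ 2 + ‖p.2‖ ^ 2) • h p := by
  have hc : Continuous fun p : ℂ × ℂ => β (‖p.1‖ ^ 2 + ‖p.2‖ ^ 2) • h p :=
    continuous_smul_of_tsupport_subset hO (continuous_euclidRadial hβ) ((tsupport_euclidRadial_subset hR₁ hβR).trans hsub) hh
  refine hc.integrable_of_hasCompactSupport ?_
  refine HasCompactSupport.intro (isCompact_closedBall (0 : ℂ × ℂ) R₁) fun p hp => ?_
  rw [mem_closedBall_zero_iff, not_le] at hp
  have : β (‖p.1‖ ^ 2 + ‖p.2‖ ^ 2) = 0 := by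
    by_contra h
    exact (lt_irrefl _) ((norm_lt_of_euclidRadial_ne_zero hR₁ hβR h).trans hp)
  rw [this, zero_smul]

/-- **Weighted mean value property on `ℂ × ℂ` for EUCLIDEAN-radial weights.**  For `f` holomorphic (`ℂ`-differentiable) on an open `U ⊆ ℂ × ℂ` containing the closed polydisc
`{max(|a|,|w|) ≤ R}`, and a continuous weight `β` with `β(s) = 0` for `s ≥ R₁²`, `0 < R₁ < R`:
`∫ β(|a|²+|w|²) • f(a,w) d(a,w) = (∫ β(|a|²+|w|²) d(a,w)) • f(0,0)`. [cite: Rudin1980, §1.4 Prop. 1.4.7] -/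
theorem integral_euclidRadial_smul_eq_smul_prod {β : ℝ → ℝ} (hβ : Continuous β) {R₁ R : ℝ} (hR₁ : 0 < R₁) (hR : R₁ < R)
    (hβR : ∀ s, R₁ ^ 2 ≤ s → β s = 0) {f : ℂ × ℂ → F} {U : Set (ℂ × ℂ)} (hU : IsOpen U) (hf : DifferentiableOn ℂ f U)
    (hsub : closedBall (0 : ℂ × ℂ) R ⊆ U) :
    ∫ p : ℂ × ℂ, β (‖p.1‖ ^ 2 + ‖p.2‖ ^ 2) • f p = (∫ p : ℂ × ℂ, β (‖p.1‖ ^ 2 + ‖p.2‖ ^ 2)) • f 0 := by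
  have hR0 : 0 < R := hR₁.trans hR
  have hsub₁ : closedBall (0 : ℂ × ℂ) R₁ ⊆ U := (closedBall_subset_closedBall hR.le).trans hsub
  -- the radial weights in one variable vanish beyond radius `R`
  have hbw : ∀ (c : ℝ) (t : ℝ), R ≤ t → β (c ^ 2 + t ^ 2) = 0 := by
    intro c t ht
    apply hβR
    nlinarith [sq_nonneg c, hR₁, hR]
  have hba : ∀ (c : ℝ) (t : ℝ), R ≤ t → β (t ^ 2 + c ^ 2) = 0 := by
    intro c t ht
    apply hβR
    nlinarith [sq_nonneg c, hR₁, hR]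
  -- integrability of the two weighted integrands
  have hI : Integrable fun p : ℂ × ℂ => β (‖p.1‖ ^ 2 + ‖p.2‖ ^ 2) • f p :=
    integrable_euclidRadial_smul hβ hR₁ hβR hU hf.continuousOn hsub₁
  have hO' : IsOpen ((fun p : ℂ × ℂ => ((p.1, 0) : ℂ × ℂ)) ⁻¹' U) := hU.preimage (by fun_prop)
  have hcont' : ContinuousOn (fun p : ℂ × ℂ => f (p.1, 0)) ((fun p : ℂ × ℂ => ((p.1, 0) : ℂ × ℂ)) ⁻¹' U) :=
    hf.continuousOn.comp (by fun_prop) fun p hp => hp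
  have hsub' : closedBall (0 : ℂ × ℂ) R₁ ⊆ (fun p : ℂ × ℂ => ((p.1, 0) : ℂ × ℂ)) ⁻¹' U := by
    intro p hp
    rw [mem_closedBall_zero_iff, Prod.norm_def] at hp
    refine hsub₁ ?_
    rw [mem_closedBall_zero_iff, Prod.norm_def]
    simp only [norm_zero]
    exact max_le ((le_max_left _ _).trans hp) hR₁.le
  have hI' : Integrable fun p : ℂ × ℂ => β (‖p.1‖ ^ 2 + ‖p.2‖ ^ 2) • f (p.1, 0) :=
    integrable_euclidRadial_smul hβ hR₁ hβR hO' hcont' hsub'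
  -- STEP 1: for each `a`, the one-variable mean value in `w`: `f(a,w) ↦ f(a,0)`
  have step1 : ∀ a : ℂ, ∫ w : ℂ, β (‖a‖ ^ 2 + ‖w‖ ^ 2) • f (a, w) = (∫ w : ℂ, β (‖a‖ ^ 2 + ‖w‖ ^ 2)) • f (a, 0) := by
    intro a
    by_cases ha : ‖a‖ < R
    · have hg : DifferentiableOn ℂ (fun w : ℂ => f (a, w)) ((fun w : ℂ => ((a, w) : ℂ × ℂ)) ⁻¹' U) :=
        hf.comp ((differentiableOn_const a).prodMk differentiableOn_id) fun w hw => hw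
      have hsubw : closedBall (0 : ℂ) R ⊆ (fun w : ℂ => ((a, w) : ℂ × ℂ)) ⁻¹' U := by
        intro w hw
        rw [mem_closedBall_zero_iff] at hw
        refine hsub ?_
        rw [mem_closedBall_zero_iff, Prod.norm_def]
        exact max_le ha.le hw
      have h := integral_radial_smul_eq_smul (b := fun t => β (‖a‖ ^ 2 + t ^ 2)) (by fun_prop) hR0 (hbw ‖a‖) hg hsubw
      beta_reduce at h
      exact h
    · have hz : ∀ w : ℂ, β (‖a‖ ^ 2 + ‖w‖ ^ 2) = 0 := fun w => hba ‖w‖ ‖a‖ (le_of_not_gt ha)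
      simp only [hz, zero_smul, integral_zero]
  -- STEP 2: for each `w`, the one-variable mean value in `a`: `f(a,0) ↦ f(0,0)`
  have step2 : ∀ w : ℂ, ∫ a : ℂ, β (‖a‖ ^ 2 + ‖w‖ ^ 2) • f (a, 0) = (∫ a : ℂ, β (‖a‖ ^ 2 + ‖w‖ ^ 2)) • f 0 := by
    intro w
    have hg : DifferentiableOn ℂ (fun a : ℂ => f (a, 0)) ((fun a : ℂ => ((a, 0) : ℂ × ℂ)) ⁻¹' U) :=
      hf.comp (differentiableOn_id.prodMk (differentiableOn_const (0 : ℂ))) fun a ha => ha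
    have hsuba : closedBall (0 : ℂ) R ⊆ (fun a : ℂ => ((a, 0) : ℂ × ℂ)) ⁻¹' U := by
      intro a ha
      rw [mem_closedBall_zero_iff] at ha
      refine hsub ?_
      rw [mem_closedBall_zero_iff, Prod.norm_def]
      simp only [norm_zero]
      exact max_le ha hR0.le
    have h := integral_radial_smul_eq_smul (b := fun t => β (t ^ 2 + ‖w‖ ^ 2)) (by fun_prop) hR0 (hba ‖w‖) hg hsuba
    beta_reduce at h
    simpa only [Prod.mk_zero_zero] using h
  calc ∫ p : ℂ × ℂ, β (‖p.1‖ ^ 2 + ‖p.2‖ ^ 2) • f p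
      = ∫ a : ℂ, ∫ w : ℂ, β (‖a‖ ^ 2 + ‖w‖ ^ 2) • f (a, w) := integral_prod _ hI
    _ = ∫ a : ℂ, ∫ w : ℂ, β (‖a‖ ^ 2 + ‖w‖ ^ 2) • f (a, 0) :=
        integral_congr_ae (Eventually.of_forall fun a => (step1 a).trans (integral_smul_const _ _).symm)
    _ = ∫ w : ℂ, ∫ a : ℂ, β (‖a‖ ^ 2 + ‖w‖ ^ 2) • f (a, 0) :=
        integral_integral_swap (f := fun (a : ℂ) (w : ℂ) => β (‖a‖ ^ 2 + ‖w‖ ^ 2) • f (a, 0)) hI'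
    _ = ∫ w : ℂ, (∫ a : ℂ, β (‖a‖ ^ 2 + ‖w‖ ^ 2)) • f 0 := integral_congr_ae (Eventually.of_forall step2)
    _ = (∫ w : ℂ, ∫ a : ℂ, β (‖a‖ ^ 2 + ‖w‖ ^ 2)) • f 0 := by rw [integral_smul_const]
    _ = (∫ p : ℂ × ℂ, β (‖p.1‖ ^ 2 + ‖p.2‖ ^ 2)) • f 0 := by
        rw [← integral_prod_symm (fun p : ℂ × ℂ => β (‖p.1‖ ^ 2 + ‖p.2‖ ^ 2)) (integrable_euclidRadial hβ hR₁ hβR)]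
        rfl

/-- The coordinate map `(a, w) ↦ ![a, w] : ℂ × ℂ → ℂ²` is differentiable (it is linear). [cite: Rudin1980, §1.4] -/
theorem differentiable_vecCons_pair : Differentiable ℂ fun p : ℂ × ℂ => (![p.1, p.2] : Fin 2 → ℂ) := by
  refine differentiable_pi.mpr fun i => ?_
  fin_cases i
  · simp
  · simp

/-- **Weighted mean value property on `ℂ² = Fin 2 → ℂ` for EUCLIDEAN-radial weights** (`|z|² = |z₀|² + |z₁|²`, the tree's `BallModel.nsq`): for `f` holomorphic on an open
`U` containing the closed sup-norm ball of radius `R` and `β` continuous with `β(s) = 0` for `s ≥ R₁²`, `0 < R₁ < R`,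
`∫ β(|z₀|²+|z₁|²) • f(z) dz = (∫ β(|z₀|²+|z₁|²) dz) • f(0)` — transport of `integral_euclidRadial_smul_eq_smul_prod` along the measure-preserving
`MeasurableEquiv.finTwoArrow`. [cite: Rudin1980, §1.4 Prop. 1.4.7] -/
theorem integral_euclidRadial_smul_eq_smul {β : ℝ → ℝ} (hβ : Continuous β) {R₁ R : ℝ} (hR₁ : 0 < R₁) (hR : R₁ < R)
    (hβR : ∀ s, R₁ ^ 2 ≤ s → β s = 0) {f : (Fin 2 → ℂ) → F} {U : Set (Fin 2 → ℂ)} (hU : IsOpen U) (hf : DifferentiableOn ℂ f U)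
    (hsub : closedBall (0 : Fin 2 → ℂ) R ⊆ U) :
    ∫ z : Fin 2 → ℂ, β (‖z 0‖ ^ 2 + ‖z 1‖ ^ 2) • f z = (∫ z : Fin 2 → ℂ, β (‖z 0‖ ^ 2 + ‖z 1‖ ^ 2)) • f 0 := by
  have hm := (volume_preserving_finTwoArrow ℂ).symm
  -- the transported function `f' (a, w) := f ![a, w]`
  set U' : Set (ℂ × ℂ) := (fun p : ℂ × ℂ => (![p.1, p.2] : Fin 2 → ℂ)) ⁻¹' U with hU'
  have hU'o : IsOpen U' := hU.preimage differentiable_vecCons_pair.continuous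
  have hf' : DifferentiableOn ℂ (fun p : ℂ × ℂ => f ![p.1, p.2]) U' :=
    hf.comp differentiable_vecCons_pair.differentiableOn fun p hp => hp
  have hsub' : closedBall (0 : ℂ × ℂ) R ⊆ U' := by
    intro p hp
    rw [mem_closedBall_zero_iff, Prod.norm_def] at hp
    refine hsub ?_
    rw [mem_closedBall_zero_iff, pi_norm_le_iff_of_nonneg ((norm_nonneg _).trans ((le_max_left _ _).trans hp))]
    intro i
    fin_cases i
    · simpa using (le_max_left _ _).trans hp
    · simpa using (le_max_right _ _).trans hp
  have key := integral_euclidRadial_smul_eq_smul_prod hβ hR₁ hR hβR hU'o hf' hsub'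
  have h0 : (![(0 : ℂ × ℂ).1, (0 : ℂ × ℂ).2] : Fin 2 → ℂ) = 0 := by
    funext i
    fin_cases i <;> rfl
  rw [← hm.integral_comp', ← hm.integral_comp']
  show ∫ p : ℂ × ℂ, β (‖(![p.1, p.2] : Fin 2 → ℂ) 0‖ ^ 2 + ‖(![p.1, p.2] : Fin 2 → ℂ) 1‖ ^ 2) • f ![p.1, p.2] =
    (∫ p : ℂ × ℂ, β (‖(![p.1, p.2] : Fin 2 → ℂ) 0‖ ^ 2 + ‖(![p.1, p.2] : Fin 2 → ℂ) 1‖ ^ 2)) • f 0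
  simp only [Matrix.cons_val_zero, Matrix.cons_val_one]
  rw [key, h0]

end TwoVariables

end Literature.Analysis.Complex

end
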